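import Summits.ResolutionOfSingularities.ResolutionOfSingularities.Theorems.HilbertSamuelEliminationSigmaMaxModificationsCorridor3WLadderIsoTailsBaseChangeTransfer
import Summits.ResolutionOfSingularities.ResolutionOfSingularities.Theorems.HilbertSamuelEliminationSigmaMaxModificationsCorridor3WLadderIsoTailsTowerBaseChangeGeomReduced
import Literature.AlgebraicGeometry.Motives.AbelianVarietyKernelDimension
import Summits.ResolutionOfSingularities.ResolutionOfSingularities.Theorems.HilbertSamuelEliminationSigmaMaxModificationsCorridor3WLadderIsoKernelCPSliceFiniteType
import HarnessLib

/-!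
# [OURS · L1 W4.2] K2-sep ROUTE A, brick (δ3, second part): **the stages `S_n` of the base change of a tower `T` over `X_0 → Spec k` along
# `X_0 ×_k K → X_0` ARE the ground-field base changes `X_n ×_k K`** (pasting of the defining squares), so everything proved for `X ×_k K`
# (reducedness, `H` pointwise, maximal origins, isolation, closed fibre points) holds for `S_n` at every point
# (crux `SigmaMaxModifications` stmt-ResolutionOfSingularities-18506 / conjunct stmt-…-19249; line `w_ladder_rows` v8.5, registered stub
# `stub_isoSepRecurrent`; res-L1-w42-plan-1 WORD 2026-08-27T16:25:47Z; design `L/res-L1-w42-stub-2/k2sep/K2SEP-DESIGN.md` §8 (δ3))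

Prover res-L1-w42-stub-2 (gen 5). Helper file `--supports stmt-ResolutionOfSingularities-19249 --as helper`; no definitions, no named fact. OURS
(cell res-hironaka, slot W4.2); NOT statements of [Hironaka2017] nor of [CossartJannsenSaito2020]. AI-written; AI review is weaker than expert
review. Stated over res-type-053's `T.bcX ι₀ n` / `T.bcι ι₀ n` (`Literature/…/BlowupTowerLocalize`) with `ι₀ := pr₁ : X_0 ×_k K → X_0`.

* `isSeparated_phi` / `quasiCompact_phi` (+ res-L1-w42-lead-1's `IdeasL1C5.locallyOfFiniteType_phi`) — `φ_n ≫ f : X_n → Spec k` keeps the structure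
  properties (blow-ups are proper).
* **`exists_isPullback_bcι`** — `∃ h : S_n ⟶ Spec K, IsPullback (ι_n) h (φ_n ≫ f) (Spec K → Spec k)`.
* **`hsFun_bcX_eq`** — `H_{S_n}(s) = H_{X_n}(ι_n s)`; **`isClosed_singleton_bcX`**, **`finite_preimage_bcι`** (over closed points);
  **`isIsolatedInHSMaxLocus_bcX`**, **`isMaximalOrigin_bcX`** — isolation and maximal origins transfer to every point of `S_n` above.

[OURS · L1 W4.2; AI-written] [cite: CossartJannsenSaito2020, Def. 2.35, Def. 13.3, p. 107] [cite: GortzWedhorn2020, Prop. 13.91 (2)]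
-/

set_option linter.dupNamespace false

noncomputable section

open scoped TensorProduct
open CategoryTheory CategoryTheory.Limits AlgebraicGeometry TopologicalSpace
open Literature.AlgebraicGeometry.Resolution Literature.AlgebraicGeometry.CossartJannsenSaito2020
open Summit.ResolutionOfSingularities.ResolutionOfSingularities.Theorems.CampaignW42

namespace Summit.ResolutionOfSingularities.ResolutionOfSingularities.Theorems.SigmaMaxModificationsCorridor3.IsoTailsHS

universe u

namespace BlowupTower

variable (T : BlowupTower.{u}) {k K : Type u} [Field k] [Field K] [Algebra k K] (f : T.X 0 ⟶ Spec (CommRingCat.of k))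

/-- `φ_n : X_n → X_0` is separated (blow-ups are proper). [folklore] -/
theorem isSeparated_phi : ∀ n, IsSeparated (T.phi n)
  | 0 => by rw [T.phi_zero]; infer_instance
  | n + 1 => by
    haveI := isSeparated_phi n
    haveI : IsLocallyNoetherian (T.X n) := T.ln n
    haveI : IsProper (T.π n) := (T.isBlowup n).isProper
    rw [T.phi_succ]; infer_instance

/-- `φ_n : X_n → X_0` is quasi-compact. [folklore] -/
theorem quasiCompact_phi : ∀ n, QuasiCompact (T.phi n)
  | 0 => by rw [T.phi_zero]; infer_instance
  | n + 1 => by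
    haveI := quasiCompact_phi n
    haveI : IsLocallyNoetherian (T.X n) := T.ln n
    haveI : IsProper (T.π n) := (T.isBlowup n).isProper
    rw [T.phi_succ]; infer_instance

/-- **`S_n = X_n ×_k K`**: pasting the defining squares `S_{m+1} = X_{m+1} ×_{X_m} S_m` over `S_0 = X_0 ×_k K` exhibits `S_n` with `ι_n` as a base
change of `φ_n ≫ f : X_n → Spec k` along `Spec K → Spec k`. [cite: GortzWedhorn2020, Prop. 13.91 (2)] [cite: CossartJannsenSaito2020, p. 107] -/
theorem exists_isPullback_bcι : ∀ n, ∃ h : T.bcX (pullback.fst f (Spec.map (CommRingCat.ofHom (algebraMap k K)))) n ⟶ Spec (CommRingCat.of K),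
    IsPullback (T.bcι (pullback.fst f (Spec.map (CommRingCat.ofHom (algebraMap k K)))) n) h (T.phi n ≫ f)
      (Spec.map (CommRingCat.ofHom (algebraMap k K)))
  | 0 => ⟨pullback.snd f _, by
      rw [T.phi_zero, Category.id_comp]
      exact IsPullback.of_hasPullback f (Spec.map (CommRingCat.ofHom (algebraMap k K)))⟩
  | n + 1 => by
    obtain ⟨h, hh⟩ := exists_isPullback_bcι n
    refine ⟨T.bcπ _ n ≫ h, ?_⟩
    rw [T.phi_succ, Category.assoc]
    exact (T.bc_isPullback _ n).paste_vert hh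

variable {T f}
variable [Algebra.IsSeparable k K] [IsSeparated f] [LocallyOfFiniteType f] [QuasiCompact f]

omit [IsSeparated f] [QuasiCompact f] in
/-- **`H_{S_n}(s) = H_{X_n}(ι_n s)` at every point** of the base-changed stage. [cite: CossartJannsenSaito2020, Def. 2.28, Lemma 2.27 (1)] -/
theorem hsFun_bcX_eq (N n : ℕ) (s : ↥(T.bcX (pullback.fst f (Spec.map (CommRingCat.ofHom (algebraMap k K)))) n)) :
    @Scheme.hsFun (T.bcX (pullback.fst f (Spec.map (CommRingCat.ofHom (algebraMap k K)))) n) N s =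
      Scheme.hsFun (T.X n) N ((T.bcι (pullback.fst f (Spec.map (CommRingCat.ofHom (algebraMap k K)))) n).base s) := by
  haveI : IsLocallyNoetherian (T.X n) := T.ln n
  haveI := Summit.ResolutionOfSingularities.ResolutionOfSingularities.Cruxes.SigmaMaxModifications.IdeasL1C5.locallyOfFiniteType_phi T n
  obtain ⟨h, hP⟩ := exists_isPullback_bcι (K := K) T f n
  haveI := isLocallyNoetherian_pullback_SpecMap (K := K) (T.phi n ≫ f)
  rw [Scheme.hsFun_eq_of_isOpenImmersion hP.isoPullback.hom N s, hsFun_pullback_SpecMap_algebraMap_eq (T.phi n ≫ f) N,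
    ← Scheme.Hom.comp_apply, hP.isoPullback_hom_fst]

omit [Algebra.IsSeparable k K] [IsSeparated f] [QuasiCompact f] in
/-- Points of `S_n` over a CLOSED point of `X_n` are closed. [folklore] -/
theorem isClosed_singleton_bcX (n : ℕ) {x : T.X n} (hx : IsClosed ({x} : Set (T.X n)))
    {s : ↥(T.bcX (pullback.fst f (Spec.map (CommRingCat.ofHom (algebraMap k K)))) n)}
    (hs : (T.bcι (pullback.fst f (Spec.map (CommRingCat.ofHom (algebraMap k K)))) n).base s = x) :
    IsClosed ({s} : Set ↥(T.bcX (pullback.fst f (Spec.map (CommRingCat.ofHom (algebraMap k K)))) n)) := by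
  haveI := Summit.ResolutionOfSingularities.ResolutionOfSingularities.Cruxes.SigmaMaxModifications.IdeasL1C5.locallyOfFiniteType_phi T n
  obtain ⟨h, hP⟩ := exists_isPullback_bcι (K := K) T f n
  set e := hP.isoPullback with he
  have hs' : (pullback.fst (T.phi n ≫ f) (Spec.map (CommRingCat.ofHom (algebraMap k K)))).base (e.hom.base s) = x := by
    rw [← Scheme.Hom.comp_apply, hP.isoPullback_hom_fst]; exact hs
  have hcl := isClosed_singleton_of_fst_eq_of_isClosed (T.phi n ≫ f) hx hs'
  have hinj : Function.Injective e.hom.base := (TopCat.homeoOfIso (Scheme.forgetToTop.mapIso e)).injective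
  have : ({s} : Set _) = e.hom.base ⁻¹' {e.hom.base s} := by
    ext t; simp only [Set.mem_singleton_iff, Set.mem_preimage]; exact ⟨fun h => h ▸ rfl, fun h => hinj h⟩
  rw [this]
  exact hcl.preimage e.hom.continuous

omit [Algebra.IsSeparable k K] [IsSeparated f] [QuasiCompact f] in
/-- The fibre of `ι_n : S_n → X_n` over a CLOSED point is finite. [folklore] -/
theorem finite_preimage_bcι (n : ℕ) {x : T.X n} (hx : IsClosed ({x} : Set (T.X n))) :
    ((T.bcι (pullback.fst f (Spec.map (CommRingCat.ofHom (algebraMap k K)))) n).base ⁻¹' {x}).Finite := by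
  haveI := Summit.ResolutionOfSingularities.ResolutionOfSingularities.Cruxes.SigmaMaxModifications.IdeasL1C5.locallyOfFiniteType_phi T n
  obtain ⟨h, hP⟩ := exists_isPullback_bcι (K := K) T f n
  set e := hP.isoPullback with he
  have hinj : Function.Injective e.hom.base := (TopCat.homeoOfIso (Scheme.forgetToTop.mapIso e)).injective
  have hfin := finite_preimage_fst_pullback_SpecMap_of_isClosed (K := K) (T.phi n ≫ f) hx
  have hsub : (T.bcι (pullback.fst f (Spec.map (CommRingCat.ofHom (algebraMap k K)))) n).base ⁻¹' {x} =
      e.hom.base ⁻¹' ((pullback.fst (T.phi n ≫ f) (Spec.map (CommRingCat.ofHom (algebraMap k K)))).base ⁻¹' {x}) := by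
    rw [← Set.preimage_comp]
    congr 1
    ext t
    change _ = ((pullback.fst (T.phi n ≫ f) _).base (e.hom.base t))
    rw [← Scheme.Hom.comp_apply, hP.isoPullback_hom_fst]
  rw [hsub]
  exact hfin.preimage hinj.injOn

omit [IsSeparated f] [QuasiCompact f] in
/-- **ISOLATION TRANSFERS TO `S_n`**: for `x ∈ X_n` closed and isolated in `(X_n)_max` and `s ∈ S_n` over `x`, `s` is isolated in `(S_n)_max`.
[cite: CossartJannsenSaito2020, Def. 13.3] -/
theorem isIsolatedInHSMaxLocus_bcX (N n : ℕ) {x : T.X n} (hiso : @IsIsolatedInHSMaxLocus (T.X n) (T.ln n) N x)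
    (hxcl : IsClosed ({x} : Set (T.X n))) {s : ↥(T.bcX (pullback.fst f (Spec.map (CommRingCat.ofHom (algebraMap k K)))) n)}
    (hs : (T.bcι (pullback.fst f (Spec.map (CommRingCat.ofHom (algebraMap k K)))) n).base s = x) :
    @IsIsolatedInHSMaxLocus (T.bcX (pullback.fst f (Spec.map (CommRingCat.ofHom (algebraMap k K)))) n)
      (by haveI := T.ln 0; haveI := isLocallyNoetherian_pullback_SpecMap (K := K) f; exact T.isLocallyNoetherian_bcX _ n) N s := by
  haveI : IsLocallyNoetherian (T.X n) := T.ln n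
  haveI : IsLocallyNoetherian (T.X 0) := T.ln 0
  haveI := isLocallyNoetherian_pullback_SpecMap (K := K) f
  haveI := T.isLocallyNoetherian_bcX (pullback.fst f (Spec.map (CommRingCat.ofHom (algebraMap k K)))) n
  exact isIsolatedInHSMaxLocus_of_hsFun_eq (T.bcι _ n) N (hsFun_bcX_eq N n)
    (fun x => by
      obtain ⟨h, hP⟩ := exists_isPullback_bcι (K := K) T f n
      obtain ⟨t, ht⟩ := surjective_fst_pullback_SpecMap_field (K := K) (T.phi n ≫ f) x
      refine ⟨hP.isoPullback.inv.base t, ?_⟩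
      rw [← Scheme.Hom.comp_apply, hP.isoPullback_inv_fst]; exact ht)
    hiso (finite_preimage_bcι n hxcl) (fun y hy => isClosed_singleton_bcX n hxcl hy) hs

/-- **MAXIMAL ORIGINS TRANSFER TO `S_n`**: for a maximal origin `(X_n, x)` at level `N`, value `ν`, characteristic `p = char k`, and `s ∈ S_n`
over `x`, `(S_n, s)` is a maximal origin at level `N`, value `ν`. [OURS · L1 W4.2] [cite: CossartJannsenSaito2020, Def. 2.35] -/
theorem isMaximalOrigin_bcX {p : ℕ} [CharP k p] (N n : ℕ) {ν : ℕ → ℕ} {x : T.X n}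
    (hO : @IsMaximalOrigin p N ν (T.X n) x)
    {s : ↥(T.bcX (pullback.fst f (Spec.map (CommRingCat.ofHom (algebraMap k K)))) n)}
    (hs : (T.bcι (pullback.fst f (Spec.map (CommRingCat.ofHom (algebraMap k K)))) n).base s = x) :
    IsMaximalOrigin p N ν (T.bcX (pullback.fst f (Spec.map (CommRingCat.ofHom (algebraMap k K)))) n) s := by
  haveI : IsLocallyNoetherian (T.X n) := T.ln n
  haveI := Summit.ResolutionOfSingularities.ResolutionOfSingularities.Cruxes.SigmaMaxModifications.IdeasL1C5.locallyOfFiniteType_phi T n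
  haveI := isSeparated_phi T n
  haveI := quasiCompact_phi T n
  haveI := hO.isReduced
  obtain ⟨h, hP⟩ := exists_isPullback_bcι (K := K) T f n
  set e := hP.isoPullback with he
  haveI := isLocallyNoetherian_pullback_SpecMap (K := K) (T.phi n ≫ f)
  have hs' : (pullback.fst (T.phi n ≫ f) (Spec.map (CommRingCat.ofHom (algebraMap k K)))).base (e.hom.base s) = x := by
    rw [← Scheme.Hom.comp_apply, hP.isoPullback_hom_fst]; exact hs
  have hO' := isMaximalOrigin_pullback_SpecMap (K := K) (T.phi n ≫ f) hO hs'
  haveI : CharP K p := charP_of_injective_algebraMap (algebraMap k K).injective p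
  haveI := hO'.isReduced
  refine isMaximalOrigin_of_hsFun_eq e.hom N (fun y => Scheme.hsFun_eq_of_isOpenImmersion e.hom N y)
    (TopCat.homeoOfIso (Scheme.forgetToTop.mapIso e)).surjective hO'
    ⟨K, inferInstance, inferInstance, e.hom ≫ pullback.snd _ _, inferInstance, inferInstance, inferInstance⟩
    (isReduced_of_isOpenImmersion e.hom)
    (le_of_eq_of_le (Literature.AlgebraicGeometry.Motives.topologicalKrullDim_eq_of_iso e) hO'.dim_le) rfl
    (isClosed_singleton_bcX n hO.isClosed hs)

end BlowupTower

end Summit.ResolutionOfSingularities.ResolutionOfSingularities.Theorems.SigmaMaxModificationsCorridor3.IsoTailsHS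

end
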